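import Summits.CriticalPhenomena.PercolationContinuityZ3.Theses.PercNearOneGluing
import Literature.Probability.Percolation.PercolationProofs
import Literature.Probability.Percolation.ConditionalPositiveAssociationProofs
import Literature.Probability.Percolation.TwoClusterConditionalAssociationProofs
import Summits.CriticalPhenomena.PercolationContinuityZ3.Theorems.PercNearOneGluingAdditiveGluingGoodStepResidual
import Summits.CriticalPhenomena.PercolationContinuityZ3.Theorems.PercNearOneGluingAdditiveGluingBlockGoodTwoRelays
import HarnessLib

/-! # Crux `PercNearOneGluing.AdditiveGluing` (stmt-CriticalPhenomena-4576), residual kernel `residualKernel` — block goodness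
# against the un-glued minimiser for ANY number of relays, up to the MULTI-HIT excess

TTRL deep seat `ttrlatt-v13177-d0` (variant V13177 = the structure class `residualKernel_two_A5` of the hypothesis `hres` of
the landed capstone `goodStep_of_residualKernel`: a bad 2-block, `A.card = 5`, drift).  Lands
`--supports stmt-CriticalPhenomena-4576`; no definitions, no named facts.

`BG` denotes the block-goodness inequality of the UN-GLUED graph against the un-glued minimiser `a₀`,
`μ(a₀↔b) + μ(a₀↮b, a₀↔S, S↔b) ≤ μ(S↔b) + Σ_{W∩A=∅} μ(K_S = W)·μ(sel W ↔ b in Wᶜ)`, `K_S = ⋃_{s∈S} C(s)`.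

* `blockGood_multiHit` (**relay-count-free multi-exchange bound**).  `μ = prodBernoulli u`; ANY relay set `A` with
  `b, a₀ ∈ A`; `a₀` a minimiser of `μ(· ↔ b)` over `A`; `S ≠ ∅` any block; `sel W ∈ A` any selection.  With the HIT events
  `E_a = {a ↔ b, a ∈ K_S, a₀ ∉ K_S}` (`a ∈ A ∖ b`; `E_{a₀} = ∅`),
  `μ(a₀↔b) + μ(a₀↮b, a₀↔S, S↔b) ≤ μ(S↔b) + Σ_{W∩A=∅} μ(K_S = W)·μ(sel W ↔ b in Wᶜ) + (Σ_{a ∈ A∖b} μ(E_a) − μ(⋃_{a ∈ A∖b} E_a))`.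
  The excess `Σ_a μ(E_a) − μ(⋃_a E_a) = E[(N − 1)⁺]`, `N = #{a ∈ A ∖ b : a ↔ b} · 1{b ∈ K_S ∌ a₀}`, is the mass of
  configurations in which the block's cluster misses `a₀` but captures the target together with AT LEAST TWO other relays,
  counted with multiplicity.  One relay besides `a₀` (`A.card ≤ 3`): the excess vanishes — the two-relay drift theorem
  `blockGood_twoRelays`; two relays (`A.card = 4`): the excess is `μ(Dbl)` of `blockGood_threeRelays_doubleHit`; so this is
  the common generalisation, and for the class `residualKernel_two_A5` (three relays besides `a₀`) it isolates the residue: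
  the multi-hit regime.
  Proof: exchange normal form at `a₀` and pocket Markov (`blockPocket_mul_offConn`, `blockPocket_sum_dead`); the dead
  pockets are charged to the relay CHOSEN BY THE SELECTION (`R_a = {W dead : sel W = a, f_a W < f₀ W}`,
  `f_a(W) = μ(K_S = W, a ↔ b)`), so no tie-breaking is needed; Kozma–Nitzan's Lemma 3 for the observer SET `S`
  (`SandwichSet.lemma3_sandwich_set`) once per relay `a ∈ A ∖ b` with the family `{a ∈ T ∌ a₀} ∪ R_a`; a union bound
  on the live-fail event `{a₀ ↔ b, b ∉ K_S, K_S ∩ A ≠ ∅} ⊆ ⋃_a {a₀ ↔ b, a ∈ K_S ∌ a₀}`; the right sides of the exchanges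
  overlap exactly in the multi-hit excess.
* `blockGood_of_noMultiHit`: hence `BG` whenever the hit events are almost surely pairwise disjoint
  (`Σ_a μ(E_a) ≤ μ(⋃_a E_a)`), for every `A`.
* `stub_blockGoodMultiHit_v13177`: the registered ∀-closed form of `blockGood_multiHit`.
* `residualKernel_multiHit_var13177` / `residualKernel_var13177_of_noMultiHit`: the exact binder shape of V13177 with the
  conclusion weakened by the excess / under the no-multi-hit hypothesis (badness, drift and the cardinalities are idle).
[cite: KozmaNitzan2024, §3.2 (Definition p. 12, Thms 4–5 pp. 12–14, Question 7 p. 36), Lemma 3 (pp. 6–7)]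
-/

namespace Summit.CriticalPhenomena.PercolationContinuityZ3.Theorems

open MeasureTheory Set
open Literature.Probability.LatticeModels (prodBernoulli)
open Literature.Probability.Percolation (BondConfig openConn openConnIn openGraph openCluster)
open scoped BigOperators

noncomputable section
open Classical

section BlockGoodMultiHit

open Literature.Probability.LatticeModels Literature.Probability.Percolation

variable {n : ℕ}

/-- **Block goodness against the un-glued minimiser for any number of relays, up to the multi-hit excess.**
See the module docstring. [cite: KozmaNitzan2024, §3.2 (Definition p. 12, Question 7 p. 36), Lemma 3 (pp. 6–7)] -/
theorem blockGood_multiHit (u : Sym2 (Fin n) → unitInterval) (A S : Finset (Fin n))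
    (b a₀ : Fin n) (sel : Finset (Fin n) → Fin n) (hbA : b ∈ A) (ha₀ : a₀ ∈ A) (hS : S.Nonempty)
    (hsel : ∀ W, sel W ∈ A)
    (hmin : ∀ a ∈ A, (prodBernoulli u).real (openConn a₀ b) ≤ (prodBernoulli u).real (openConn a b)) :
    (prodBernoulli u).real (openConn a₀ b)
        + (prodBernoulli u).real
            ((openConn a₀ b)ᶜ ∩ (⋃ s ∈ S, openConn a₀ s) ∩ (⋃ s ∈ S, openConn s b))
      ≤ (prodBernoulli u).real (⋃ s ∈ S, openConn s b)
        + ∑ W ∈ (Finset.univ : Finset (Finset (Fin n))).filter (fun W => Disjoint W A),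
            (prodBernoulli u).real {ω : BondConfig (Fin n) | ∀ z : Fin n, (z ∈ W ↔ ω ∈ ⋃ s ∈ S, openConn s z)}
              * (prodBernoulli u).real (openConnIn ((W : Set (Fin n))ᶜ) (sel W) b)
        + (∑ a ∈ A.erase b, (prodBernoulli u).real
              (openConn a b ∩ ((⋃ s ∈ S, openConn s a) ∩ (⋃ s ∈ S, openConn s a₀)ᶜ))
            - (prodBernoulli u).real
              (⋃ a ∈ A.erase b, (openConn a b ∩ ((⋃ s ∈ S, openConn s a) ∩ (⋃ s ∈ S, openConn s a₀)ᶜ)))) := by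
  set μ := prodBernoulli u with hμ
  have hms : ∀ s : Set (BondConfig (Fin n)), MeasurableSet s := fun _ => MeasurableSet.of_discrete
  -- notation
  set KW : Finset (Fin n) → Set (BondConfig (Fin n)) :=
    fun W => {ω : BondConfig (Fin n) | ∀ z : Fin n, (z ∈ W ↔ ω ∈ ⋃ s ∈ S, openConn s z)} with hKW
  set Y : Set (BondConfig (Fin n)) := ⋃ s ∈ S, openConn s b with hY
  set Xs : Set (BondConfig (Fin n)) := ⋃ s ∈ S, openConn a₀ s with hXs
  set X₀ : Set (BondConfig (Fin n)) := ⋃ s ∈ S, openConn s a₀ with hX₀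
  set Z : Set (BondConfig (Fin n)) := {ω | ∃ a ∈ A, ω ∈ ⋃ s ∈ S, openConn s a} with hZ
  set 𝒟 : Finset (Finset (Fin n)) := (Finset.univ : Finset (Finset (Fin n))).filter (fun W => Disjoint W A) with h𝒟
  set I : Finset (Fin n) := A.erase b with hI
  set f : Fin n → Finset (Fin n) → ℝ := fun a W => μ.real (KW W ∩ openConn a b) with hf
  set g : Finset (Fin n) → ℝ := fun W => μ.real (KW W) * μ.real (openConnIn ((W : Set (Fin n))ᶜ) (sel W) b) with hg
  set E : Fin n → Set (BondConfig (Fin n)) := fun a => openConn a b ∩ ((⋃ s ∈ S, openConn s a) ∩ X₀ᶜ) with hE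
  set L : Fin n → Set (BondConfig (Fin n)) := fun a => openConn a₀ b ∩ ((⋃ s ∈ S, openConn s a) ∩ X₀ᶜ) with hL
  have hmemY : ∀ ω, ω ∈ Y ↔ ∃ s ∈ S, (openGraph ω).Reachable s b := fun ω => by
    simp only [hY, Set.mem_iUnion, exists_prop]; exact Iff.rfl
  have hmemX₀ : ∀ ω, ω ∈ X₀ ↔ ∃ s ∈ S, (openGraph ω).Reachable s a₀ := fun ω => by
    simp only [hX₀, Set.mem_iUnion, exists_prop]; exact Iff.rfl
  have hmemXa : ∀ (ω : BondConfig (Fin n)) (a : Fin n),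
      (ω ∈ ⋃ s ∈ S, openConn s a) ↔ ∃ s ∈ S, (openGraph ω).Reachable s a := fun ω a => by
    simp only [Set.mem_iUnion, exists_prop]; exact Iff.rfl
  have hmemZ : ∀ ω, ω ∈ Z ↔ ∃ a ∈ A, ∃ s ∈ S, (openGraph ω).Reachable s a := fun ω => by
    simp only [hZ, Set.mem_setOf_eq, hmemXa]
  have hXs' : Xs = X₀ := by
    simp only [hXs, hX₀, knThm2_openConn_comm a₀]
  have hmem𝒟 : ∀ W, W ∈ 𝒟 ↔ Disjoint W A := fun W => by simp [h𝒟]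
  have hmemI : ∀ a, a ∈ I ↔ a ≠ b ∧ a ∈ A := fun a => Finset.mem_erase
  -- (S1) the dead part of `τ(a₀)` is the fibre sum of `f a₀`
  have hP3 : μ.real (openConn a₀ b ∩ Yᶜ ∩ Zᶜ) = ∑ W ∈ 𝒟, f a₀ W := by
    have h := blockPocket_sum_dead u S A (openConn a₀ b)
    simp only [hf, h𝒟, hKW]
    rw [h]
    congr 1; ext ω
    simp only [Set.mem_inter_iff, Set.mem_compl_iff, Set.mem_setOf_eq, hmemY, hmemZ, hmemXa,
      not_exists, not_and]
    constructor
    · rintro ⟨⟨hab, -⟩, hZc⟩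
      exact ⟨hab, fun a ha s hs hsa => hZc a ha s hs hsa⟩
    · rintro ⟨hab, hdead⟩
      exact ⟨⟨hab, fun s hs hsb => hdead b hbA s hs hsb⟩, fun a ha s hs hsa => hdead a ha s hs hsa⟩
  -- (S2) `τ(a₀) = P1 + P2 + P3`
  have hτ : μ.real (openConn a₀ b) = μ.real (openConn a₀ b ∩ Y) + μ.real (openConn a₀ b ∩ Yᶜ ∩ Z)
      + μ.real (openConn a₀ b ∩ Yᶜ ∩ Zᶜ) := by
    have e1 := measureReal_inter_add_sdiff (μ := μ) (s := openConn a₀ b) (hms Y) (measure_ne_top _ _)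
    have e2 := measureReal_inter_add_sdiff (μ := μ) (s := openConn a₀ b ∩ Yᶜ) (hms Z) (measure_ne_top _ _)
    rw [Set.sdiff_eq] at e1 e2
    linarith
  -- (S3) `μ(Y) = Q1 + Q2 + Q3`
  have hYd : μ.real Y = μ.real (openConn a₀ b ∩ Y)
      + μ.real ((openConn a₀ b)ᶜ ∩ Xs ∩ Y) + μ.real (Y ∩ (openConn a₀ b)ᶜ ∩ Xsᶜ) := by
    have e1 := measureReal_inter_add_sdiff (μ := μ) (s := Y) (hms (openConn a₀ b)) (measure_ne_top _ _)
    have e2 := measureReal_inter_add_sdiff (μ := μ) (s := Y ∩ (openConn a₀ b)ᶜ) (hms Xs) (measure_ne_top _ _)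
    rw [Set.sdiff_eq] at e1 e2
    rw [Set.inter_comm Y (openConn a₀ b)] at e1
    have e3 : Y ∩ (openConn a₀ b)ᶜ ∩ Xs = (openConn a₀ b)ᶜ ∩ Xs ∩ Y := by
      ext ω; simp only [Set.mem_inter_iff]; tauto
    rw [e3] at e2
    linarith
  -- (S4) pocket Markov: the selected pocket term is `f (sel W) W`
  have hgf : ∀ W ∈ 𝒟, g W = f (sel W) W := by
    intro W hW
    have hWA : Disjoint W A := (hmem𝒟 W).1 hW
    have hselW : sel W ∉ W := fun h => Finset.disjoint_left.1 hWA h (hsel W)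
    exact blockPocket_mul_offConn u S W hS (sel W) b hselW
  -- (S5) each dead pocket is charged to the relay chosen by the selection
  set d : Fin n → Finset (Fin n) → ℝ :=
    fun a W => if (sel W = a ∧ f a W < f a₀ W) then f a₀ W - f a W else 0 with hd
  have hd0 : ∀ a W, 0 ≤ d a W := by
    intro a W
    simp only [hd]
    split_ifs with h
    · linarith [h.2]
    · exact le_rfl
  have hpt : ∀ W ∈ 𝒟, f a₀ W - g W ≤ ∑ a ∈ I, d a W := by
    intro W hW
    rw [hgf W hW]
    have hsum0 : 0 ≤ ∑ a ∈ I, d a W := Finset.sum_nonneg fun a _ => hd0 a W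
    by_cases hsb : sel W = b
    · -- the target is selected: `f b W = μ(K_S = W) ≥ f a₀ W`
      have hle : f a₀ W ≤ f (sel W) W := by
        rw [hsb]
        simp only [hf]
        refine measureReal_mono (Set.inter_subset_inter_right _ fun ω _ => ?_) (measure_ne_top _ _)
        exact (SimpleGraph.Reachable.refl b : (openGraph ω).Reachable b b)
      linarith
    · have hselI : sel W ∈ I := (hmemI (sel W)).2 ⟨hsb, hsel W⟩
      have hsingle : d (sel W) W ≤ ∑ a ∈ I, d a W :=
        Finset.single_le_sum (f := fun a => d a W) (fun a _ => hd0 a W) hselI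
      have hdsel : f a₀ W - f (sel W) W ≤ d (sel W) W := by
        simp only [hd, true_and]
        split_ifs with h
        · exact le_rfl
        · linarith [not_lt.1 h]
      linarith
  -- (S6) summing over the dead pockets and exchanging the sums
  set R : Fin n → Finset (Finset (Fin n)) := fun a => 𝒟.filter (fun W => sel W = a ∧ f a W < f a₀ W) with hR
  have hEX : ∑ W ∈ 𝒟, f a₀ W - ∑ W ∈ 𝒟, g W ≤ ∑ a ∈ I, (∑ W ∈ R a, f a₀ W - ∑ W ∈ R a, f a W) := by
    have h1 : ∑ W ∈ 𝒟, f a₀ W - ∑ W ∈ 𝒟, g W ≤ ∑ W ∈ 𝒟, ∑ a ∈ I, d a W := by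
      rw [← Finset.sum_sub_distrib]
      exact Finset.sum_le_sum hpt
    have h2 : ∑ W ∈ 𝒟, ∑ a ∈ I, d a W = ∑ a ∈ I, ∑ W ∈ 𝒟, d a W := Finset.sum_comm
    have h3 : ∀ a, ∑ W ∈ 𝒟, d a W = ∑ W ∈ R a, f a₀ W - ∑ W ∈ R a, f a W := by
      intro a
      rw [← Finset.sum_sub_distrib]
      simp only [hR, hd, Finset.sum_filter]
    rw [h2] at h1
    simpa only [h3] using h1
  -- (S7) Lemma 3 for the observer set `S`, once per relay `a ∈ A ∖ b`
  have hRA : ∀ a, ∀ W ∈ R a, Disjoint W A := fun a W hW => (hmem𝒟 W).1 (Finset.mem_filter.1 hW).1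
  have hex : ∀ a ∈ I, μ.real (L a) + ∑ W ∈ R a, f a₀ W ≤ μ.real (E a) + ∑ W ∈ R a, f a W := by
    intro a haI
    have haA : a ∈ A := ((hmemI a).1 haI).2
    have hRa : ∀ W ∈ R a, a ∉ W := fun W hW h => Finset.disjoint_left.1 (hRA a W hW) h haA
    set 𝓕 : Set (Set (Fin n)) :=
      {T : Set (Fin n) | a ∈ T ∧ a₀ ∉ T} ∪ {T | ∃ W ∈ R a, T = (W : Set (Fin n))} with h𝓕
    have hlo : ∀ ω : BondConfig (Fin n), a ∈ (⋃ s ∈ S, openCluster ω s) → a₀ ∉ (⋃ s ∈ S, openCluster ω s) →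
        (⋃ s ∈ S, openCluster ω s) ∈ 𝓕 := fun ω h2 h0 => Or.inl ⟨h2, h0⟩
    have hhi : ∀ ω : BondConfig (Fin n), (⋃ s ∈ S, openCluster ω s) ∈ 𝓕 → a₀ ∉ (⋃ s ∈ S, openCluster ω s) := by
      rintro ω (⟨-, h0⟩ | ⟨W, hW, hWe⟩)
      · exact h0
      · rw [hWe]
        exact fun h => Finset.disjoint_left.1 (hRA a W hW) (Finset.mem_coe.1 h) ha₀
    have hsand := SandwichSet.lemma3_sandwich_set u a₀ a b S 𝓕 hlo hhi (hmin a haA)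
    have hpart₀ := real_inter_blockSandwichFamily u S a₀ a (R a) hRa (openConn a₀ b)
    have hpart₁ := real_inter_blockSandwichFamily u S a₀ a (R a) hRa (openConn a b)
    rw [hpart₀, hpart₁] at hsand
    have hsum₀ : ∑ W ∈ R a, μ.real ({ω : BondConfig (Fin n) | ∀ z : Fin n, (z ∈ W ↔ ω ∈ ⋃ s ∈ S, openConn s z)} ∩
        openConn a₀ b) = ∑ W ∈ R a, f a₀ W := rfl
    have hsum₁ : ∑ W ∈ R a, μ.real ({ω : BondConfig (Fin n) | ∀ z : Fin n, (z ∈ W ↔ ω ∈ ⋃ s ∈ S, openConn s z)} ∩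
        openConn a b) = ∑ W ∈ R a, f a W := rfl
    rw [hsum₀, hsum₁] at hsand
    exact hsand
  -- (S8) sum of the exchanges
  have hexSum : ∑ a ∈ I, μ.real (L a) + ∑ a ∈ I, (∑ W ∈ R a, f a₀ W - ∑ W ∈ R a, f a W)
      ≤ ∑ a ∈ I, μ.real (E a) := by
    rw [← Finset.sum_add_distrib]
    exact Finset.sum_le_sum fun a haI => by linarith [hex a haI]
  -- (S9) union bound on the live-fail event
  have hP2 : μ.real (openConn a₀ b ∩ Yᶜ ∩ Z) ≤ ∑ a ∈ I, μ.real (L a) := by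
    refine (measureReal_mono (fun ω hω => ?_) (measure_ne_top _ _)).trans (measureReal_biUnion_finset_le I L)
    simp only [Set.mem_inter_iff, Set.mem_compl_iff, hmemY, hmemZ, not_exists, not_and] at hω
    obtain ⟨⟨hab, hYc⟩, a, ha, s, hs, hsa⟩ := hω
    have hab' : (openGraph ω).Reachable a₀ b := hab
    have haneb : a ≠ b := by
      rintro rfl
      exact hYc s hs hsa
    have hX0c : ω ∉ X₀ := fun h0 => by
      obtain ⟨s', hs', hs'0⟩ := (hmemX₀ ω).1 h0
      exact hYc s' hs' (hs'0.trans hab')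
    exact Set.mem_iUnion₂.2 ⟨a, (hmemI a).2 ⟨haneb, ha⟩, hab, (hmemXa ω a).2 ⟨s, hs, hsa⟩, hX0c⟩
  -- (S10) the hit events lie in `{b ∈ K_S, a₀ ↮ b, a₀ ∉ K_S}`
  have hUE : μ.real (⋃ a ∈ I, E a) ≤ μ.real (Y ∩ (openConn a₀ b)ᶜ ∩ Xsᶜ) := by
    rw [hXs']
    refine measureReal_mono (fun ω hω => ?_) (measure_ne_top _ _)
    obtain ⟨a, -, hωa⟩ := Set.mem_iUnion₂.1 hω
    simp only [hE, Set.mem_inter_iff, Set.mem_compl_iff] at hωa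
    obtain ⟨hab, hXa, hX0c⟩ := hωa
    obtain ⟨s, hs, hsa⟩ := (hmemXa ω a).1 hXa
    have hab' : (openGraph ω).Reachable a b := hab
    have hX0c' : ∀ s' ∈ S, ¬ (openGraph ω).Reachable s' a₀ := fun s' hs' h =>
      hX0c ((hmemX₀ ω).2 ⟨s', hs', h⟩)
    refine ⟨⟨(hmemY ω).2 ⟨s, hs, hsa.trans hab'⟩, fun h0b => hX0c' s hs ?_⟩, hX0c⟩
    exact (hsa.trans hab').trans (show (openGraph ω).Reachable a₀ b from h0b).symm
  -- combine
  have hgoal : ∑ W ∈ (Finset.univ : Finset (Finset (Fin n))).filter (fun W => Disjoint W A),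
      μ.real {ω : BondConfig (Fin n) | ∀ z : Fin n, (z ∈ W ↔ ω ∈ ⋃ s ∈ S, openConn s z)}
        * μ.real (openConnIn ((W : Set (Fin n))ᶜ) (sel W) b) = ∑ W ∈ 𝒟, g W := rfl
  have hdef : ∑ a ∈ A.erase b, μ.real (openConn a b ∩ ((⋃ s ∈ S, openConn s a) ∩ X₀ᶜ))
      = ∑ a ∈ I, μ.real (E a) := rfl
  have hdefU : μ.real (⋃ a ∈ A.erase b, (openConn a b ∩ ((⋃ s ∈ S, openConn s a) ∩ X₀ᶜ)))
      = μ.real (⋃ a ∈ I, E a) := rfl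
  rw [hgoal, hdef, hdefU]
  linarith [hP3, hτ, hYd, hP2, hexSum, hEX, hUE]

/-- **Block goodness for any number of relays off the multi-hit regime**: if the hit events
`E_a = {a ↔ b, a ∈ K_S, a₀ ∉ K_S}`, `a ∈ A ∖ b`, carry no excess (`Σ_a μ(E_a) ≤ μ(⋃_a E_a)`, i.e. they are a.s.
pairwise disjoint), the block kernel holds against the un-glued minimiser.
[cite: KozmaNitzan2024, §3.2 (Definition p. 12, Question 7 p. 36), Lemma 3 (pp. 6–7)] -/
theorem blockGood_of_noMultiHit (u : Sym2 (Fin n) → unitInterval) (A S : Finset (Fin n))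
    (b a₀ : Fin n) (sel : Finset (Fin n) → Fin n) (hbA : b ∈ A) (ha₀ : a₀ ∈ A) (hS : S.Nonempty)
    (hsel : ∀ W, sel W ∈ A)
    (hmin : ∀ a ∈ A, (prodBernoulli u).real (openConn a₀ b) ≤ (prodBernoulli u).real (openConn a b))
    (hno : ∑ a ∈ A.erase b, (prodBernoulli u).real
          (openConn a b ∩ ((⋃ s ∈ S, openConn s a) ∩ (⋃ s ∈ S, openConn s a₀)ᶜ))
        ≤ (prodBernoulli u).real
          (⋃ a ∈ A.erase b, (openConn a b ∩ ((⋃ s ∈ S, openConn s a) ∩ (⋃ s ∈ S, openConn s a₀)ᶜ)))) :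
    (prodBernoulli u).real (openConn a₀ b)
        + (prodBernoulli u).real
            ((openConn a₀ b)ᶜ ∩ (⋃ s ∈ S, openConn a₀ s) ∩ (⋃ s ∈ S, openConn s b))
      ≤ (prodBernoulli u).real (⋃ s ∈ S, openConn s b)
        + ∑ W ∈ (Finset.univ : Finset (Finset (Fin n))).filter (fun W => Disjoint W A),
            (prodBernoulli u).real {ω : BondConfig (Fin n) | ∀ z : Fin n, (z ∈ W ↔ ω ∈ ⋃ s ∈ S, openConn s z)}
              * (prodBernoulli u).real (openConnIn ((W : Set (Fin n))ᶜ) (sel W) b) := by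
  have h := blockGood_multiHit u A S b a₀ sel hbA ha₀ hS hsel hmin
  linarith

end BlockGoodMultiHit

open Literature.Probability.LatticeModels Literature.Probability.Percolation in
/-- **Registered stub `stub_blockGoodMultiHit_v13177`** (= `blockGood_multiHit` on `Fin n`, ∀-closed): block goodness against the
un-glued minimiser for any relay set, any block `S ≠ ∅` and any selection, up to the multi-hit excess
`Σ_{a ∈ A∖b} μ(E_a) − μ(⋃_{a ∈ A∖b} E_a)`, `E_a = {a ↔ b, a ∈ K_S, a₀ ∉ K_S}`.
[cite: KozmaNitzan2024, §3.2 (Definition p. 12, Question 7 p. 36), Lemma 3 (pp. 6–7)] -/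
theorem stub_blockGoodMultiHit_v13177 : ∀ (n : ℕ) (u : Sym2 (Fin n) → unitInterval) (A S : Finset (Fin n)) (b a₀ : Fin n) (sel : Finset (Fin n) → Fin n), b ∈ A → a₀ ∈ A → S.Nonempty → (∀ W, sel W ∈ A) → (∀ a ∈ A, (prodBernoulli u).real (openConn a₀ b) ≤ (prodBernoulli u).real (openConn a b)) → (prodBernoulli u).real (openConn a₀ b) + (prodBernoulli u).real ((openConn a₀ b)ᶜ ∩ (⋃ s ∈ S, openConn a₀ s) ∩ (⋃ s ∈ S, openConn s b)) ≤ (prodBernoulli u).real (⋃ s ∈ S, openConn s b) + ∑ W ∈ (Finset.univ : Finset (Finset (Fin n))).filter (fun W => Disjoint W A), (prodBernoulli u).real {ω : BondConfig (Fin n) | ∀ z : Fin n, (z ∈ W ↔ ω ∈ ⋃ s ∈ S, openConn s z)} * (prodBernoulli u).real (openConnIn ((W : Set (Fin n))ᶜ) (sel W) b) + (∑ a ∈ A.erase b, (prodBernoulli u).real (openConn a b ∩ ((⋃ s ∈ S, openConn s a) ∩ (⋃ s ∈ S, openConn s a₀)ᶜ)) - (prodBernoulli u).real (⋃ a ∈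 A.erase b, (openConn a b ∩ ((⋃ s ∈ S, openConn s a) ∩ (⋃ s ∈ S, openConn s a₀)ᶜ)))) :=
  fun _ u A S b a₀ sel hb ha₀ hS hsel hmin => blockGood_multiHit u A S b a₀ sel hb ha₀ hS hsel hmin

open Literature.Probability.LatticeModels Literature.Probability.Percolation in
/-- **V13177 (`residualKernel_two_A5`) up to the multi-hit excess**: the exact binder shape of TTRL variant V13177 of
`stmt-CriticalPhenomena-4576` (bad 2-block disjoint from `A`, `A.card = 5`, drift) with the conclusion weakened by the
multi-hit excess `Σ_{a ∈ A∖b} μ(E_a) − μ(⋃_{a ∈ A∖b} E_a)`, `E_a = {a ↔ b, a ∈ K_S, a₀ ∉ K_S}` (`blockGood_multiHit`; the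
badness, drift and cardinality hypotheses are idle).  The multi-hit regime is the open residue of V13177.
[cite: KozmaNitzan2024, §3.2 (Definition p. 12, Question 7 p. 36), Lemma 3 (pp. 6–7)] -/
theorem residualKernel_multiHit_var13177 : ∀ (n : ℕ) (u : Sym2 (Fin n) → unitInterval) (A S : Finset (Fin n)) (b a₀ : Fin n) (sel : Finset (Fin n) → Fin n), b ∈ A → Disjoint S A → S.card = 2 → A.card = 5 → (∀ W, sel W ∈ A) → a₀ ∈ A → (∀ a ∈ A, (prodBernoulli u).real (openConn a₀ b) ≤ (prodBernoulli u).real (openConn a b)) → (∀ v ∈ S, (prodBernoulli u).real (openConn v b) < (prodBernoulli u).real (openConn a₀ b)) → (∃ a ∈ A, (prodBernoulli (fun e : Sym2 (Fin n) => if (∀ x ∈ e, x ∈ S) ∧ ¬ e.IsDiag then 1 else u e)).real (openConn a b) < (prodBernoulli (fun e : Sym2 (Fin n) => if (∀ x ∈ e, x ∈ S) ∧ ¬ e.IsDiag then 1 else u e)).real (openConn a₀ b)) → (prodBernoulli u).real (openConn a₀ b) + (prodBernoulli u).real ((openConn a₀ b)ᶜ ∩ (⋃ s ∈ S, openConn a₀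 s) ∩ (⋃ s ∈ S, openConn s b)) ≤ (prodBernoulli u).real (⋃ s ∈ S, openConn s b) + ∑ W ∈ (Finset.univ : Finset (Finset (Fin n))).filter (fun W => Disjoint W A), (prodBernoulli u).real {ω : BondConfig (Fin n) | ∀ z : Fin n, (z ∈ W ↔ ω ∈ ⋃ s ∈ S, openConn s z)} * (prodBernoulli u).real (openConnIn ((W : Set (Fin n))ᶜ) (sel W) b) + (∑ a ∈ A.erase b, (prodBernoulli u).real (openConn a b ∩ ((⋃ s ∈ S, openConn s a) ∩ (⋃ s ∈ S, openConn s a₀)ᶜ)) - (prodBernoulli u).real (⋃ a ∈ A.erase b, (openConn a b ∩ ((⋃ s ∈ S, openConn s a) ∩ (⋃ s ∈ S, openConn s a₀)ᶜ)))) :=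
  fun _ u A S b a₀ sel hb _hSA hS2 _hA5 hsel ha₀ hmin _hbad _hdrift =>
    blockGood_multiHit u A S b a₀ sel hb ha₀ (Finset.card_pos.1 (by omega)) hsel hmin

open Literature.Probability.LatticeModels Literature.Probability.Percolation in
/-- **V13177 (`residualKernel_two_A5`) off the multi-hit regime**: the exact binder shape of TTRL variant V13177 of
`stmt-CriticalPhenomena-4576` with the no-multi-hit hypothesis `Σ_{a ∈ A∖b} μ(E_a) ≤ μ(⋃_{a ∈ A∖b} E_a)` added
(`blockGood_of_noMultiHit`).  [cite: KozmaNitzan2024, §3.2 (Definition p. 12, Question 7 p. 36), Lemma 3 (pp. 6–7)] -/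
theorem residualKernel_var13177_of_noMultiHit : ∀ (n : ℕ) (u : Sym2 (Fin n) → unitInterval) (A S : Finset (Fin n)) (b a₀ : Fin n) (sel : Finset (Fin n) → Fin n), b ∈ A → Disjoint S A → S.card = 2 → A.card = 5 → (∀ W, sel W ∈ A) → a₀ ∈ A → (∀ a ∈ A, (prodBernoulli u).real (openConn a₀ b) ≤ (prodBernoulli u).real (openConn a b)) → (∀ v ∈ S, (prodBernoulli u).real (openConn v b) < (prodBernoulli u).real (openConn a₀ b)) → (∃ a ∈ A, (prodBernoulli (fun e : Sym2 (Fin n) => if (∀ x ∈ e, x ∈ S) ∧ ¬ e.IsDiag then 1 else u e)).real (openConn a b) < (prodBernoulli (fun e : Sym2 (Fin n) => if (∀ x ∈ e, x ∈ S) ∧ ¬ e.IsDiag then 1 else u e)).real (openConn a₀ b)) → (∑ a ∈ A.erase b, (prodBernoulli u).real (openConn a b ∩ ((⋃ s ∈ S, openConn s a) ∩ (⋃ s ∈ S, openConn s a₀)ᶜ)) ≤ (prodBernoulli u).real (⋃ a ∈ A.erase b, (openConn a b ∩ ((⋃ s ∈ S, openConn s a) ∩ (⋃ s ∈ S, openConn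 s a₀)ᶜ)))) → (prodBernoulli u).real (openConn a₀ b) + (prodBernoulli u).real ((openConn a₀ b)ᶜ ∩ (⋃ s ∈ S, openConn a₀ s) ∩ (⋃ s ∈ S, openConn s b)) ≤ (prodBernoulli u).real (⋃ s ∈ S, openConn s b) + ∑ W ∈ (Finset.univ : Finset (Finset (Fin n))).filter (fun W => Disjoint W A), (prodBernoulli u).real {ω : BondConfig (Fin n) | ∀ z : Fin n, (z ∈ W ↔ ω ∈ ⋃ s ∈ S, openConn s z)} * (prodBernoulli u).real (openConnIn ((W : Set (Fin n))ᶜ) (sel W) b) :=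
  fun _ u A S b a₀ sel hb _hSA hS2 _hA5 hsel ha₀ hmin _hbad _hdrift hno =>
    blockGood_of_noMultiHit u A S b a₀ sel hb ha₀ (Finset.card_pos.1 (by omega)) hsel hmin hno

end

end Summit.CriticalPhenomena.PercolationContinuityZ3.Theorems
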